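import Literature.Algebra.EuclideanLattices.MRVerifierMachineLink
import Literature.Computability.Complexity.AOWListMatrixFP
import HarnessLib

/-!
# The integer verifier of MR07 Thm. 5.23 in the typed `CodeFP` algebra

Topic `Algebra/EuclideanLattices` (family `pqc`). `MRVerifierMachine.lean` realises the all-integer verifier
`intAcceptsZ` of the machine-level Micciancio–Regev Thm. 5.23 as a raw `FP` string function `verdictF` on the
record `inp yd t D a b P u`, and `MRVerifierMachineLink.lean` proves `verdictF (inp …) = [true] ↔ intAcceptsZ …`
under one magnitude bound. The reduction machine is assembled in the TYPED algebra `CodeFP` (its other parts —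
instance readers, the dual loop of Cor. 5.13, the sampler, the blocks of `W`-runs — are `CodeFP` maps), so this
file re-reads the verifier there:

* `VArgs`, `vArgsE` — the verifier's arguments `(W, n, t, D, a, b, N, P, u)` (yardstick width `W`, lists for
  `t` and the witness rows `u`) and their code, which IS the record `inp (1^W) …` (`vArgsE_eq_inp`:
  `rowCode = rawE intE ∘ ofFn`, `matCode = matE ∘ rows`);
* `verdictT` — the verdict as a typed Boolean, `decide (verdictF (vArgsE x) = [true])`; **`verdictT_codeFP`**;
* `vTupE`, `vTup_recode` — the same arguments in a plain nested-pair code (how producers write them);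
* **`verdictT_eq_true_iff`** — on `ofFn` data within the magnitude bounds, `verdictT … = true ↔ intAcceptsZ t a b D P u`.

All proved; definitions with bodies (`vArgsE`, `verdictT`, `vTupE`); no named fact.

## References

* D. Micciancio, O. Regev, *Worst-case to average-case reductions based on Gaussian measures*, SIAM J. Comput.
  37 (2007) 267–302; authors' version, Thm. 5.23 (the verifier `V`, p. 28) — integer form.
* S. Arora, B. Barak, *Computational Complexity: A Modern Approach*, CUP 2009, §1.3 [AroraBarak2009].
-/

namespace Literature.Algebra.EuclideanLattices

open _root_.Computability Literature.Computability.Complexity Literature.Computability.Complexity.CodeFP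
  Literature.Computability.Complexity.Brick Literature.Computability.Complexity.LMat LLLMachine

namespace MRVerifierMachine

/-- The verifier's typed arguments `(W, (n, (t, (D, (a, (b, (N, (P, u))))))))`. [folklore] -/
abbrev VArgs : Type := ℕ × (ℕ × (List ℤ × (ℕ × (ℤ × (ℤ × (ℕ × (ℕ × List (List ℤ))))))))

/-- **The code of the arguments is the verifier's record** `recOf 1^W (bin n) (zlist t) (dpEnc D) (bin D) (dpEnc a)
(dpEnc b) (bin N) (bin P) (matE u)`. [cite: MicciancioRegev2007, Thm. 5.23 (the verifier V) — integer form] -/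
def vArgsE (x : VArgs) : List Bool :=
  recOf (unE x.1) (natE x.2.1) (rawE intE x.2.2.1) (intE (x.2.2.2.1 : ℤ)) (natE x.2.2.2.1) (intE x.2.2.2.2.1)
    (intE x.2.2.2.2.2.1) (natE x.2.2.2.2.2.2.1) (natE x.2.2.2.2.2.2.2.1) (matE x.2.2.2.2.2.2.2.2)

/-- **The verdict as a typed Boolean.** [cite: MicciancioRegev2007, Thm. 5.23 (the verifier V) — integer form] -/
noncomputable def verdictT (x : VArgs) : Bool := decide (verdictF (vArgsE x) = [true])

/-- `w ↦ [w = [true]]` is typed polynomial time. [folklore] -/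
theorem isTrueBit_codeFP : CodeFP strE bitE (fun w : List Bool => decide (w = [true])) :=
  ((CodeFP.eq (eα := strE) (fun _ _ h => h)).comp ((CodeFP.id strE).pair (const strE [true])) :)

/-- **The verdict is typed polynomial time** (`verdictF ∈ FP`). [cite: AroraBarak2009, §1.3] -/
theorem verdictT_codeFP : CodeFP vArgsE bitE verdictT :=
  isTrueBit_codeFP.comp (of_fn (eα := vArgsE) (eβ := strE) (g := fun x => verdictF (vArgsE x)) verdictF verdictF_mem_FP fun _ => rfl)

/-- The plain nested-pair code of the arguments, with `D` written twice (difference pair and binary):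
`(W, (n, (t, ((D : ℤ), (D, (a, (b, (N, (P, u)))))))))`. [folklore] -/
abbrev vTupE : ℕ × (ℕ × (List ℤ × (ℤ × (ℕ × (ℤ × (ℤ × (ℕ × (ℕ × List (List ℤ))))))))) → List Bool :=
  pairE unE (pairE natE (pairE (rawE intE) (pairE intE (pairE natE (pairE intE (pairE intE (pairE natE (pairE natE matE))))))))

/-- The arguments with `D` duplicated. [folklore] -/
def vTup (x : VArgs) : ℕ × (ℕ × (List ℤ × (ℤ × (ℕ × (ℤ × (ℤ × (ℕ × (ℕ × List (List ℤ))))))))) :=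
  (x.1, (x.2.1, (x.2.2.1, ((x.2.2.2.1 : ℤ), (x.2.2.2.1, x.2.2.2.2)))))

/-- `vArgsE x = vTupE (vTup x)`. [folklore] -/
theorem vArgsE_eq (x : VArgs) : vArgsE x = vTupE (vTup x) := rfl

/-- **Producers write the record through the plain code**: `x ↦ x` from `vTupE ∘ vTup` to `vArgsE` is the identity
string function; so a `CodeFP _ vTupE (vTup ∘ g)` map is a `CodeFP _ vArgsE g` map. [folklore] -/
theorem codeFP_vArgsE_of_vTup {σ : Type} {eσ : σ → List Bool} {g : σ → VArgs} (h : CodeFP eσ vTupE (fun s => vTup (g s))) :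
    CodeFP eσ vArgsE g :=
  h.recodeOut fun s => (vArgsE_eq (g s)).symm

/-- `vTup` is typed polynomial time from the plain code WITHOUT the duplicate (`intOfNat` writes `dpEnc D`). [folklore] -/
abbrev vPlainE : VArgs → List Bool :=
  pairE unE (pairE natE (pairE (rawE intE) (pairE natE (pairE intE (pairE intE (pairE natE (pairE natE matE)))))))

/-- From the plain code of the arguments to the record. [cite: AroraBarak2009, §1.3] -/
theorem vArgs_recode : CodeFP vPlainE vArgsE (fun x => x) := by
  have hW : CodeFP vPlainE unE (fun x => x.1) := fst _ _
  have hn : CodeFP vPlainE natE (fun x => x.2.1) := (snd _ _).fst'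
  have ht : CodeFP vPlainE (rawE intE) (fun x => x.2.2.1) := (snd _ _).snd'.fst'
  have hD : CodeFP vPlainE natE (fun x => x.2.2.2.1) := (snd _ _).snd'.snd'.fst'
  have hrest : CodeFP vPlainE (pairE intE (pairE intE (pairE natE (pairE natE matE)))) (fun x => x.2.2.2.2) :=
    (snd _ _).snd'.snd'.snd'
  have hDz : CodeFP vPlainE intE (fun x => ((x.2.2.2.1 : ℕ) : ℤ)) := intOfNat.comp hD
  have h : CodeFP vPlainE vTupE (fun x => vTup x) :=
    (hW.pair (hn.pair (ht.pair (hDz.pair (hD.pair hrest)))) :)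
  exact codeFP_vArgsE_of_vTup h

/-! ### The value on `ofFn` data -/

/-- The record of `ofFn` data is `inp`. [folklore] -/
theorem vArgsE_ofFn {n N : ℕ} (W : ℕ) (t : Fin n → ℤ) (D : ℕ) (a b : ℤ) (P : ℕ) (u : Fin N → Fin n → ℤ) :
    vArgsE (W, (n, (List.ofFn t, (D, (a, (b, (N, (P, List.ofFn fun j => List.ofFn (u j))))))))) = inp (unE W) t D a b P u := by
  have hmat : matE (List.ofFn fun j => List.ofFn (u j)) = matCode u := by
    show encList (List.map (rawE intE) (List.ofFn fun j => List.ofFn (u j))) = encList (List.ofFn fun j => rowCode (u j))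
    rw [List.map_ofFn]
    rfl
  show recOf (unE W) (natE n) (rawE intE (List.ofFn t)) (intE (D : ℤ)) (natE D) (intE a) (intE b) (natE N) (natE P)
      (matE (List.ofFn fun j => List.ofFn (u j))) = inp (unE W) t D a b P u
  rw [hmat]
  rfl

/-- **The typed verdict is `intAcceptsZ`** on `ofFn` data within the magnitude bounds of
`verdictF_eq_true_iff` (`W ≥ n, N, P`; `D > 0`; `P ≥ 1`; `|u j i| ≤ U < 2^W`; `D < 2^W`;
`n²(n N U²)^{2^P} < 2^W`; `(100a²)^{2^P} < 2^W`; `(3 N D² b²)^{2^P} < 2^W`).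
[cite: MicciancioRegev2007, Thm. 5.23 (the verifier V, p. 28) — integer form] -/
theorem verdictT_eq_true_iff {n N : ℕ} (W : ℕ) (t : Fin n → ℤ) (D : ℕ) (a : ℤ) (b P : ℕ) (u : Fin N → Fin n → ℤ)
    {U : ℕ} (hn : n ≤ W) (hN : N ≤ W) (hPW : P ≤ W) (hD : 0 < D) (hP : 1 ≤ P) (hu : ∀ j i, (u j i).natAbs ≤ U)
    (hUW : U < 2 ^ W) (hDW : D < 2 ^ W) (hGW : n ^ 2 * (n * (N * U ^ 2)) ^ 2 ^ P < 2 ^ W)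
    (hα : (100 * (a * a)).natAbs ^ 2 ^ P < 2 ^ W) (hβ : (3 * (N : ℤ) * ((D : ℤ) * D) * ((b : ℤ) * b)).natAbs ^ 2 ^ P < 2 ^ W) :
    verdictT (W, (n, (List.ofFn t, (D, (a, ((b : ℤ), (N, (P, List.ofFn fun j => List.ofFn (u j))))))))) = true ↔
      MicciancioRegev2007.VerifierZ.intAcceptsZ t a b D P u := by
  rw [verdictT, decide_eq_true_eq, vArgsE_ofFn]
  have hlen : (unE W).length = W := length_unE W
  exact verdictF_eq_true_iff (unE W) t D a b P u (by rw [hlen]; exact hn) (by rw [hlen]; exact hN) (by rw [hlen]; exact hPW)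
    hD hP hu (by rw [hlen]; exact hUW) (by rw [hlen]; exact hDW) (by rw [hlen]; exact hGW) (by rw [hlen]; exact hα)
    (by rw [hlen]; exact hβ)

end MRVerifierMachine

end Literature.Algebra.EuclideanLattices
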